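import Literature.NumberTheory.Automorphic.AsaiSignContOfAsaiHolomorphyMW
import HarnessLib

/-!
# The conjugate-self-dual stratum of `GrbacShahidi2015_partialAsaiL_at_one` from Grbac–Shahidi's
# holomorphy and Arthur–Clozel's (2.3) alone — and, in ranks `N ≤ 2`, from the holomorphy alone

Topic `NumberTheory/Automorphic`; namespace `Literature.NumberTheory.Automorphic`.  Proof file
(theorems only: no definition, no named fact, no instance) of the provefact unit
`GrbacShahidi2015_partialAsaiL_at_one` (`AsaiSignContinuation`; Grbac–Shahidi 2015, Thm. 4.3 read at
`s = 1`: for a cuspidal `Π` on `GL_N(𝔸_E)`, `E/F` quadratic, unitary almost everywhere, every Asai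
datum `(S, A)` and every sign `η`, the partial product converges far to the right and
`(s - 1)^k L^S(s, Π, As^η)`, `k ≤ 1`, continues holomorphically to `{1 < Re s} ∪ B(1, δ)` with a
non-zero value at `s = 1`), sibling of `AsaiSignCont` §AtOne, `AsaiAtOneOfHolomorphy`,
`AsaiAtOneRankOne`, `AsaiAtOneOfL2`, `AsaiAtOneOfAsaiHolomorphy`, `AsaiAtOneOfMoeglinWaldspurger` and
`AsaiAtOneOfFacts`.

## What this file does

After `AsaiAtOneOfFacts` the whole fact is an implication between NAMED facts of the tree,
`GrbacShahidi2015_partialAsaiL_holomorphy → (∀ E N μ, MoeglinWaldspurger1989_partialPairL_of_eq_conj) →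
GrbacShahidi2015_partialAsaiL_at_one` (`GrbacShahidi2015_partialAsaiL_at_one_of_facts`): Grbac–Shahidi's
holomorphy (Thm. 4.3 (1), (2)(a), `hGS`) and Mœglin–Waldspurger's Corollaire (ii) (the entire
continuation of `s (s - 1) L^S(s, π ⊗ π̄)`, `hMW`), the second serving — through de la Vallée Poussin
positivity and Landau's lemma — for the Rankin–Selberg input of Grbac–Shahidi's order count at `s = 1`
(proof of Thm. 4.3, last paragraph, pp. 205–206, Remark 4.4).  The sibling unit of Mok's dichotomy
(`AsaiSignContOfAsaiHolomorphyMW`, 2026-08-16) has meanwhile shown that for a CONJUGATE SELF-DUAL `Π`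
the Rankin–Selberg input is only Arthur–Clozel's (2.3) — the simple pole of `L^S(s, π ⊗ π̃)` at `s = 1`,
the named fact `JacquetShalika1981_partialPairL_pole_of_eq_conj`, strictly weaker than Corollaire (ii)
(`JacquetShalika1981_partialPairL_pole_of_eq_conj_of_moeglinWaldspurger`) and a THEOREM of the tree in
ranks `≤ 2` (`JacquetShalika1981_partialPairL_pole_of_eq_conj_holds_of_le_two`) — and proved
`Mok2014_partialAsaiL_continuation_pole_dichotomy_of_GrbacShahidi2015_of_JS`.  This file threads that
through the conjugate-self-dual stratum of `GrbacShahidi2015_partialAsaiL_at_one` (Grbac–Shahidi's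
clause (2): "exactly one of the `L`-functions `L(s, σ, r_A)` and `L(s, σ ⊗ δ̂, r_A)` has simple poles
at `s = 0` and `s = 1`, while the other is holomorphic at those points", pp. 186 and 204), which
`AsaiSignCont` derived from Mok's dichotomy (`GrbacShahidi2015_partialAsaiL_at_one_of_continuation_dichotomy`):

* `AutomorphicRepData.partialAsaiL_at_one_of_hasAsaiPoleCont_of_hasAsaiHolAtOneCont`,
  `AutomorphicRepData.partialAsaiL_at_one_of_sign_continuations` — bookkeeping: a continued pole sign
  `η₀` (`HasAsaiPoleCont c η₀`, `HasAsaiHolAtOneCont c (-η₀)`), resp. the body of Mok's dichotomy for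
  one `Π`, gives the body of `GrbacShahidi2015_partialAsaiL_at_one` at every Asai datum and EVERY sign
  (`k = 1` for `η₀`, `k = 0` for `-η₀`, `δ = 1/2`);
* `CuspidalAutomorphicRepData.GrbacShahidi2015_partialAsaiL_at_one_of_asaiEntire_of_JS` — **for ONE
  conjugate self-dual cuspidal `Π` on `GL_N(𝔸_E)`, the body of the fact at every datum and sign follows
  from Grbac–Shahidi's (2)(a) in `L²_cusp(GL_N(𝔸_E))` at these `F, E, c, N` (`hGSa`) and (2.3) in
  rank `N` over `E` (`h23`)** — nothing else (pointwise form);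
* `CuspidalAutomorphicRepData.GrbacShahidi2015_partialAsaiL_at_one_of_asaiEntire_of_le_two` — **in
  ranks `N ≤ 2` the same from `hGSa` ALONE** ((2.3) being a theorem there: the pole of the partial
  Dedekind zeta function in rank `1`, the Kirillov `L²`-bound in rank `2`);
* `GrbacShahidi2015_partialAsaiL_at_one_of_GrbacShahidi2015_of_JS_of_isConjSelfDualAE` — **the
  conjugate-self-dual stratum of the named fact from the two NAMED FACTS
  `GrbacShahidi2015_partialAsaiL_holomorphy` and `JacquetShalika1981_partialPairL_pole_of_eq_conj`**
  (global form), and `…_of_GrbacShahidi2015_of_le_two_of_isConjSelfDualAE` — in ranks `N ≤ 2` from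
  `GrbacShahidi2015_partialAsaiL_holomorphy` alone.

So the leaf sets of the fact, stratum by stratum, are now: conjugate self-dual `Π` —
`{hGS, (2.3)}`, and `{hGS}` in ranks `≤ 2`; all `Π` — `{hGS, Corollaire (ii)}`
(`GrbacShahidi2015_partialAsaiL_at_one_of_facts`).  The gap between the two is genuine and is NOT
closed here: for a `Π` whose `A_G`-normalisation `Π₀` is not conjugate self-dual, the order count at
`s = 1` needs the NON-VANISHING of the cross term `L^{S_E}(1 + it, Π₀ × Π₀^c)`, `t ∈ ℝ` (Grbac–Shahidi,
(∗∗) p. 205; Jacquet–Shahidi / Shahidi 1981), and the tree's only road to it without Eisenstein series —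
de la Vallée Poussin positivity for `Π₀ ⊞ (Π₀^c)^∨` with Landau's lemma
(`PairLFunctionPolesRankNeLandau`, `PairLFunctionBoundaryLandau`, `PairLFunctionPolesLandauHalfPlane`) —
asks for the continuation of the DIAGONAL terms `(s - 1) L^{S_E}(s, Π₀ × Π̄₀)` to a right half-plane
`{A < Re s}` with `A < 1/(2N)`; these are Rankin–Selberg functions over `E`, not Asai products, so
neither `hGS` nor (2.3) (a statement at `s = 1` only) supplies them: Corollaire (ii) does.  For a
conjugate self-dual `Π` (normalised, `Π^c ≅ Π^∨ ≅ Π̄`) the diagonal term IS the cross term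
`L^S(As⁺) L^S(As⁻)`, continued by `hGS`, and only the EXISTENCE of its pole at `s = 1` ((2.3)) is used.

## References

* N. Grbac, F. Shahidi, *Endoscopic transfer for unitary groups and holomorphy of Asai
  `L`-functions*, Pacific J. Math. 276 (2015), 185–211: Thm. 4.3 (pp. 186, 204), its proof
  pp. 204–206 ((∗∗) p. 205), Remark 4.4. [GrbacShahidi2015]
* C. P. Mok, *Endoscopic classification of representations of quasi-split unitary groups*,
  Mem. Amer. Math. Soc. 235 (2015), no. 1108, §2.5 and Thm. 2.5.4 (a), p. 20. [Mok2014]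
* J. Arthur, L. Clozel, *Simple algebras, base change, and the advanced theory of the trace formula*,
  Ann. of Math. Stud. 120 (1989), Ch. 3 §2, (2.3), p. 171. [ArthurClozelAMS120]
* C. Mœglin, J.-L. Waldspurger, *Le spectre résiduel de `GL(n)`*, Ann. Sci. ÉNS (4) 22 (1989),
  Appendice, Corollaire (ii), p. 667. [MoeglinWaldspurger1989]
-/

noncomputable section

open scoped Topology Classical
open NumberField IsDedekindDomain Filter Polynomial MeasureTheory

namespace Literature.NumberTheory.Automorphic

open AdelicGroupData

variable {F E : Type} [Field F] [NumberField F] [Field E] [NumberField E] [Algebra F E]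
  {N : ℕ} {hcpt : isCompact_glFiniteIntegralLevel N E} {c : E ≃ₐ[F] E}

/-! ### Bookkeeping: from a continued pole sign to the body of the fact at every sign -/

namespace AutomorphicRepData

/-- **A continued pole sign gives the body of `GrbacShahidi2015_partialAsaiL_at_one` at every datum
and every sign.**  If `(s - 1) L^S(s, Π, As^{η₀})` continues to `{1/2 < Re s}` with non-zero value at
`1` at every Asai datum (`HasAsaiPoleCont c η₀`) and `L^S(s, Π, As^{-η₀})` does likewise
(`HasAsaiHolAtOneCont c (-η₀)`), then for every datum `(S, A)` and sign `η` the conclusion of the fact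
holds: `k = 1` for `η = η₀` (`HasAsaiPoleCont.partialAsaiL_at_one`), `k = 0` for `η = -η₀`
(`HasAsaiHolAtOneCont.partialAsaiL_at_one`), `δ = 1/2`.  (The case split of
`GrbacShahidi2015_partialAsaiL_at_one_of_continuation_dichotomy` in `AsaiSignCont`, isolated.)
[cite: GrbacShahidi2015, Thm. 4.3 (2), pp. 186 and 204] -/
theorem partialAsaiL_at_one_of_hasAsaiPoleCont_of_hasAsaiHolAtOneCont
    {π : AutomorphicRepData (AutomorphyDatum.gl N E hcpt)} {η₀ : ℤˣ}
    (hpole : π.HasAsaiPoleCont c η₀) (hhol : π.HasAsaiHolAtOneCont c (-η₀))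
    {S : Set (HeightOneSpectrum (𝓞 F))} {A : SatakeFamily E} (η : ℤˣ) (hSA : π.IsAsaiDatum c S A) :
    ∃ σ₀ : ℝ, 1 ≤ σ₀ ∧
      (∀ s : ℂ, σ₀ < s.re →
        Multipliable fun v : {v : HeightOneSpectrum (𝓞 F) // v ∉ S} =>
          ((asaiLocalPolynomial c A η (placeAbove E v.1)).eval ((v.1.residueCard : ℂ) ^ (-s)))⁻¹) ∧
      ∃ (k : ℕ) (δ : ℝ) (G : ℂ → ℂ), k ≤ 1 ∧ 0 < δ ∧
        DifferentiableOn ℂ G ({s : ℂ | 1 < s.re} ∪ Metric.ball 1 δ) ∧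
        (∀ s : ℂ, σ₀ < s.re → G s = (s - 1) ^ k * partialAsaiL S c A η s) ∧ G 1 ≠ 0 := by
  by_cases hη : η = η₀
  · subst hη
    exact hpole.partialAsaiL_at_one hSA
  · obtain rfl : η = -η₀ := Int.units_ne_iff_eq_neg.mp hη
    exact hhol.partialAsaiL_at_one hSA

/-- **The body of Mok's dichotomy for one `Π` gives the body of `GrbacShahidi2015_partialAsaiL_at_one`
for that `Π`, at every datum and every sign**: a sign `η₀` such that at every Asai datum both partial
products converge far to the right, `(s - 1) L^S(s, Π, As^{η₀})` continues to `{1/2 < Re s}` non-zero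
at `1` and `L^S(s, Π, As^{-η₀})` continues to `{1/2 < Re s}` non-zero at `1`, packages into
`HasAsaiPoleCont c η₀ ∧ HasAsaiHolAtOneCont c (-η₀)` (as in `exists_hasAsaiPoleCont`), whence the
previous theorem. [cite: Mok2014, §2.5 and Thm. 2.5.4 (a), p. 20]
[cite: GrbacShahidi2015, Thm. 4.3 (2), pp. 186 and 204] -/
theorem partialAsaiL_at_one_of_sign_continuations
    {π : AutomorphicRepData (AutomorphyDatum.gl N E hcpt)}
    (h : ∃ η₀ : ℤˣ, ∀ (S : Set (HeightOneSpectrum (𝓞 F))) (A : SatakeFamily E),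
      π.IsAsaiDatum c S A →
        ∃ σ₀ : ℝ, 1 ≤ σ₀ ∧
          (∀ (θ : ℤˣ) (s : ℂ), σ₀ < s.re →
            Multipliable fun v : {v : HeightOneSpectrum (𝓞 F) // v ∉ S} =>
              ((asaiLocalPolynomial c A θ (placeAbove E v.1)).eval
                ((v.1.residueCard : ℂ) ^ (-s)))⁻¹) ∧
          (∃ G : ℂ → ℂ, DifferentiableOn ℂ G {s : ℂ | 1 / 2 < s.re} ∧
            (∀ s : ℂ, σ₀ < s.re → G s = (s - 1) * partialAsaiL S c A η₀ s) ∧ G 1 ≠ 0) ∧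
          (∃ H : ℂ → ℂ, DifferentiableOn ℂ H {s : ℂ | 1 / 2 < s.re} ∧
            (∀ s : ℂ, σ₀ < s.re → H s = partialAsaiL S c A (-η₀) s) ∧ H 1 ≠ 0))
    {S : Set (HeightOneSpectrum (𝓞 F))} {A : SatakeFamily E} (η : ℤˣ) (hSA : π.IsAsaiDatum c S A) :
    ∃ σ₀ : ℝ, 1 ≤ σ₀ ∧
      (∀ s : ℂ, σ₀ < s.re →
        Multipliable fun v : {v : HeightOneSpectrum (𝓞 F) // v ∉ S} =>
          ((asaiLocalPolynomial c A η (placeAbove E v.1)).eval ((v.1.residueCard : ℂ) ^ (-s)))⁻¹) ∧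
      ∃ (k : ℕ) (δ : ℝ) (G : ℂ → ℂ), k ≤ 1 ∧ 0 < δ ∧
        DifferentiableOn ℂ G ({s : ℂ | 1 < s.re} ∪ Metric.ball 1 δ) ∧
        (∀ s : ℂ, σ₀ < s.re → G s = (s - 1) ^ k * partialAsaiL S c A η s) ∧ G 1 ≠ 0 := by
  obtain ⟨η₀, hη₀⟩ := h
  have hpole : π.HasAsaiPoleCont c η₀ := fun S' A' hSA' => by
    obtain ⟨σ₀, hσ₀, hmul, hG, -⟩ := hη₀ S' A' hSA'
    exact ⟨σ₀, hσ₀, fun s hs => hmul η₀ s hs, hG⟩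
  have hhol : π.HasAsaiHolAtOneCont c (-η₀) := fun S' A' hSA' => by
    obtain ⟨σ₀, hσ₀, hmul, -, hH⟩ := hη₀ S' A' hSA'
    exact ⟨σ₀, hσ₀, fun s hs => hmul (-η₀) s hs, hH⟩
  exact partialAsaiL_at_one_of_hasAsaiPoleCont_of_hasAsaiHolAtOneCont hpole hhol η hSA

end AutomorphicRepData

/-! ### One conjugate self-dual `Π`: from (2)(a) and (2.3) at its own `(F, E, c, N)` -/

namespace CuspidalAutomorphicRepData

/-- **`GrbacShahidi2015_partialAsaiL_at_one` for ONE conjugate self-dual cuspidal `Π`, from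
Grbac–Shahidi's (2)(a) and Arthur–Clozel's (2.3) at its rank — nothing else** (pointwise form).  For a
quadratic `E/F` (`c ≠ 1`), `N ≥ 1`, a cuspidal `Π` on `GL_N(𝔸_E)` conjugate self-dual almost
everywhere (`IsConjSelfDualAE`), granted (2)(a) in `L²_cusp(GL_N(𝔸_E))` for these `F, E, c, N` and
every automorphic measure (`hGSa`: `s (s - 1) L^S(s, P, As^η)` is the restriction of an entire
function on some `{σ₀ < Re s}` — the first conjunct of `GrbacShahidi2015_partialAsaiL_holomorphy` at
`(F, E, c, N)`) and (2.3) in rank `N` over `E` (`h23`, the named fact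
`JacquetShalika1981_partialPairL_pole_of_eq_conj`): at every Asai datum `(S, A)` and every sign `η` the
conclusion of the fact holds.  Proof: the body of Mok's dichotomy for `Π` from these inputs
(`exists_sign_partialAsaiL_continuation_of_asaiEntire_of_JS`, sibling unit: Mok's / Grbac–Shahidi's
order count at `s = 1` in `L^{S_E}(s, Π × Π^c) = L^S(As⁺) L^S(As⁻)`, whose left side has a pole at `1`
by (2.3) and whose factors have order `≥ -1` by (2)(a)), then
`partialAsaiL_at_one_of_sign_continuations`.  No unitarity hypothesis is needed (a conjugate self-dual
`Π` is normalised).  [cite: GrbacShahidi2015, Thm. 4.3 (2) pp. 186/204 and its proof pp. 204–206]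
[cite: Mok2014, §2.5 and Thm. 2.5.4 (a), p. 20] [cite: ArthurClozelAMS120, Ch. 3 §2 (2.3)] -/
theorem GrbacShahidi2015_partialAsaiL_at_one_of_asaiEntire_of_JS
    (hGSa : ∀ (μ : Measure (gl N E).automorphicQuotient) [(gl N E).IsAutomorphicMeasure μ]
      (P : CuspidalAutomorphicRepGL N E μ) (S : Set (HeightOneSpectrum (𝓞 F))) (A : SatakeFamily E)
      (η : ℤˣ), S.Finite →
      IsSatakeFamilyOf P {w : HeightOneSpectrum (𝓞 E) | w.under (𝓞 F) ∈ S} A →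
      (∀ w : HeightOneSpectrum (𝓞 E), w.under (𝓞 F) ∉ S → c • w = w →
        w.asIdeal.inertiaDeg (𝓞 F) = 2) →
      ∃ σ₀ : ℝ, 1 ≤ σ₀ ∧ ∃ G : ℂ → ℂ, Differentiable ℂ G ∧
        ∀ s : ℂ, σ₀ < s.re → G s = s * (s - 1) * partialAsaiL S c A η s)
    (h23 : ∀ (μ : Measure (gl N E).automorphicQuotient) [(gl N E).IsAutomorphicMeasure μ],
      JacquetShalika1981_partialPairL_pole_of_eq_conj (n := N) (K := E) (μ := μ))
    (h2 : Module.finrank F E = 2) (hc : c ≠ 1) (hN : 0 < N) (π : CuspidalAutomorphicRepData N E hcpt)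
    (hπ : π.1.IsConjSelfDualAE c) {S : Set (HeightOneSpectrum (𝓞 F))} {A : SatakeFamily E} (η : ℤˣ)
    (hSA : π.1.IsAsaiDatum c S A) :
    ∃ σ₀ : ℝ, 1 ≤ σ₀ ∧
      (∀ s : ℂ, σ₀ < s.re →
        Multipliable fun v : {v : HeightOneSpectrum (𝓞 F) // v ∉ S} =>
          ((asaiLocalPolynomial c A η (placeAbove E v.1)).eval ((v.1.residueCard : ℂ) ^ (-s)))⁻¹) ∧
      ∃ (k : ℕ) (δ : ℝ) (G : ℂ → ℂ), k ≤ 1 ∧ 0 < δ ∧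
        DifferentiableOn ℂ G ({s : ℂ | 1 < s.re} ∪ Metric.ball 1 δ) ∧
        (∀ s : ℂ, σ₀ < s.re → G s = (s - 1) ^ k * partialAsaiL S c A η s) ∧ G 1 ≠ 0 :=
  AutomorphicRepData.partialAsaiL_at_one_of_sign_continuations
    (π.exists_sign_partialAsaiL_continuation_of_asaiEntire_of_JS hGSa h23 h2 hc hN hπ) η hSA

/-- **In ranks `N ≤ 2`: `GrbacShahidi2015_partialAsaiL_at_one` for one conjugate self-dual cuspidal
`Π` from Grbac–Shahidi's (2)(a) at `(F, E, c, N)` ALONE.**  Arthur–Clozel's (2.3) is a theorem of the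
tree in ranks `≤ 2` (`JacquetShalika1981_partialPairL_pole_of_eq_conj_holds_of_le_two`), so the
previous theorem needs only `hGSa` (via `exists_sign_partialAsaiL_continuation_of_asaiEntire_of_le_two`);
in rank `1` even `hGSa` is a theorem (`GrbacShahidi2015_partialAsaiL_holomorphy_rank_one`,
`PartialAsaiLHolomorphyRankOne`) and the whole fact is proved outright
(`GrbacShahidi2015_partialAsaiL_at_one_rank_one`, `AsaiAtOneRankOne`).
[cite: GrbacShahidi2015, Thm. 4.3 (2), pp. 186/204] [cite: ArthurClozelAMS120, Ch. 3 §2 (2.3)] -/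
theorem GrbacShahidi2015_partialAsaiL_at_one_of_asaiEntire_of_le_two
    (hGSa : ∀ (μ : Measure (gl N E).automorphicQuotient) [(gl N E).IsAutomorphicMeasure μ]
      (P : CuspidalAutomorphicRepGL N E μ) (S : Set (HeightOneSpectrum (𝓞 F))) (A : SatakeFamily E)
      (η : ℤˣ), S.Finite →
      IsSatakeFamilyOf P {w : HeightOneSpectrum (𝓞 E) | w.under (𝓞 F) ∈ S} A →
      (∀ w : HeightOneSpectrum (𝓞 E), w.under (𝓞 F) ∉ S → c • w = w →
        w.asIdeal.inertiaDeg (𝓞 F) = 2) →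
      ∃ σ₀ : ℝ, 1 ≤ σ₀ ∧ ∃ G : ℂ → ℂ, Differentiable ℂ G ∧
        ∀ s : ℂ, σ₀ < s.re → G s = s * (s - 1) * partialAsaiL S c A η s)
    (h2 : Module.finrank F E = 2) (hc : c ≠ 1) (hN : 0 < N) (hN2 : N ≤ 2)
    (π : CuspidalAutomorphicRepData N E hcpt) (hπ : π.1.IsConjSelfDualAE c)
    {S : Set (HeightOneSpectrum (𝓞 F))} {A : SatakeFamily E} (η : ℤˣ) (hSA : π.1.IsAsaiDatum c S A) :
    ∃ σ₀ : ℝ, 1 ≤ σ₀ ∧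
      (∀ s : ℂ, σ₀ < s.re →
        Multipliable fun v : {v : HeightOneSpectrum (𝓞 F) // v ∉ S} =>
          ((asaiLocalPolynomial c A η (placeAbove E v.1)).eval ((v.1.residueCard : ℂ) ^ (-s)))⁻¹) ∧
      ∃ (k : ℕ) (δ : ℝ) (G : ℂ → ℂ), k ≤ 1 ∧ 0 < δ ∧
        DifferentiableOn ℂ G ({s : ℂ | 1 < s.re} ∪ Metric.ball 1 δ) ∧
        (∀ s : ℂ, σ₀ < s.re → G s = (s - 1) ^ k * partialAsaiL S c A η s) ∧ G 1 ≠ 0 :=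
  AutomorphicRepData.partialAsaiL_at_one_of_sign_continuations
    (π.exists_sign_partialAsaiL_continuation_of_asaiEntire_of_le_two hGSa h2 hc hN hN2 hπ) η hSA

end CuspidalAutomorphicRepData

/-! ### The conjugate-self-dual stratum from the NAMED FACTS -/

/-- **The conjugate-self-dual stratum of `GrbacShahidi2015_partialAsaiL_at_one` from the two NAMED
FACTS `GrbacShahidi2015_partialAsaiL_holomorphy` and `JacquetShalika1981_partialPairL_pole_of_eq_conj`
alone.**  Printed (Grbac–Shahidi 2015, Thm. 4.3 (2), pp. 186 and 204): for a Galois self-dual cuspidal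
`σ` on `GL_n(𝔸_E)`, "(a) `L(s, σ, r_A)` is entire, except for possible simple poles at `s = 0` and
`s = 1`, and nonzero for `Re(s) ≥ 1` and `Re(s) ≤ 0`; (b) exactly one of the `L`-functions
`L(s, σ, r_A)` and `L(s, σ ⊗ δ̂, r_A)` has simple poles at `s = 0` and `s = 1`, while the other is
holomorphic at those points."  Proved here: granted the holomorphy clauses of Thm. 4.3 as vendored
(`hGS`, of which only (2)(a) is used) and Arthur–Clozel's (2.3) over every number field, in every rank,
for every automorphic measure (`h23`), the conclusion of `GrbacShahidi2015_partialAsaiL_at_one` holds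
for every conjugate self-dual cuspidal `Π` on `GL_N(𝔸_E)` (`[E : F] = 2`, `c ≠ 1`, `N ≥ 1`), every
Asai datum and every sign — by `GrbacShahidi2015_partialAsaiL_at_one_of_continuation_dichotomy`
(`AsaiSignCont`) applied to `Mok2014_partialAsaiL_continuation_pole_dichotomy_of_GrbacShahidi2015_of_JS`
(`AsaiSignContOfAsaiHolomorphyMW`).  Compared with `GrbacShahidi2015_partialAsaiL_at_one_of_facts`
(all `Π`, second input Mœglin–Waldspurger's Corollaire (ii)) the second input is the weaker (2.3); the
restriction to conjugate self-dual `Π` is essential (module docstring).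
[cite: GrbacShahidi2015, Thm. 4.3 (2), pp. 186 and 204, proof pp. 204–206]
[cite: Mok2014, §2.5 and Thm. 2.5.4 (a), p. 20] [cite: ArthurClozelAMS120, Ch. 3 §2 (2.3)] -/
theorem GrbacShahidi2015_partialAsaiL_at_one_of_GrbacShahidi2015_of_JS_of_isConjSelfDualAE
    (hGS : GrbacShahidi2015_partialAsaiL_holomorphy)
    (h23 : ∀ (K : Type) [Field K] [NumberField K] (n : ℕ)
      (μ : Measure (gl n K).automorphicQuotient) [(gl n K).IsAutomorphicMeasure μ],
      JacquetShalika1981_partialPairL_pole_of_eq_conj (n := n) (K := K) (μ := μ))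
    (h2 : Module.finrank F E = 2) (hc : c ≠ 1) (hN : 0 < N) (π : CuspidalAutomorphicRepData N E hcpt)
    (hπ : π.1.IsConjSelfDualAE c) {S : Set (HeightOneSpectrum (𝓞 F))} {A : SatakeFamily E} (η : ℤˣ)
    (hSA : π.1.IsAsaiDatum c S A) :
    ∃ σ₀ : ℝ, 1 ≤ σ₀ ∧
      (∀ s : ℂ, σ₀ < s.re →
        Multipliable fun v : {v : HeightOneSpectrum (𝓞 F) // v ∉ S} =>
          ((asaiLocalPolynomial c A η (placeAbove E v.1)).eval ((v.1.residueCard : ℂ) ^ (-s)))⁻¹) ∧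
      ∃ (k : ℕ) (δ : ℝ) (G : ℂ → ℂ), k ≤ 1 ∧ 0 < δ ∧
        DifferentiableOn ℂ G ({s : ℂ | 1 < s.re} ∪ Metric.ball 1 δ) ∧
        (∀ s : ℂ, σ₀ < s.re → G s = (s - 1) ^ k * partialAsaiL S c A η s) ∧ G 1 ≠ 0 :=
  GrbacShahidi2015_partialAsaiL_at_one_of_continuation_dichotomy
    (Mok2014_partialAsaiL_continuation_pole_dichotomy_of_GrbacShahidi2015_of_JS hGS h23) h2 hc hN π hπ
    η hSA

/-- **In ranks `N ≤ 2`: the conjugate-self-dual stratum of `GrbacShahidi2015_partialAsaiL_at_one` from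
the named fact `GrbacShahidi2015_partialAsaiL_holomorphy` ALONE** (its clause (2)(a) at `(F, E, c, N)`;
(2.3) is `JacquetShalika1981_partialPairL_pole_of_eq_conj_holds_of_le_two`).  So at `N = 2` the only
unproved input of the fact for conjugate self-dual `Π` is Grbac–Shahidi's holomorphy — the Asai
`L`-functions of `GL_2` (Asai 1977; Langlands–Shahidi on `U(2, 2)`), absent from the tree.
[cite: GrbacShahidi2015, Thm. 4.3 (2), pp. 186 and 204] [cite: ArthurClozelAMS120, Ch. 3 §2 (2.3)] -/
theorem GrbacShahidi2015_partialAsaiL_at_one_of_GrbacShahidi2015_of_le_two_of_isConjSelfDualAE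
    (hGS : GrbacShahidi2015_partialAsaiL_holomorphy)
    (h2 : Module.finrank F E = 2) (hc : c ≠ 1) (hN : 0 < N) (hN2 : N ≤ 2)
    (π : CuspidalAutomorphicRepData N E hcpt) (hπ : π.1.IsConjSelfDualAE c)
    {S : Set (HeightOneSpectrum (𝓞 F))} {A : SatakeFamily E} (η : ℤˣ) (hSA : π.1.IsAsaiDatum c S A) :
    ∃ σ₀ : ℝ, 1 ≤ σ₀ ∧
      (∀ s : ℂ, σ₀ < s.re →
        Multipliable fun v : {v : HeightOneSpectrum (𝓞 F) // v ∉ S} =>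
          ((asaiLocalPolynomial c A η (placeAbove E v.1)).eval ((v.1.residueCard : ℂ) ^ (-s)))⁻¹) ∧
      ∃ (k : ℕ) (δ : ℝ) (G : ℂ → ℂ), k ≤ 1 ∧ 0 < δ ∧
        DifferentiableOn ℂ G ({s : ℂ | 1 < s.re} ∪ Metric.ball 1 δ) ∧
        (∀ s : ℂ, σ₀ < s.re → G s = (s - 1) ^ k * partialAsaiL S c A η s) ∧ G 1 ≠ 0 :=
  π.GrbacShahidi2015_partialAsaiL_at_one_of_asaiEntire_of_le_two
    (fun μ _ P S' A' θ hS' hA' hinert => by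
      obtain ⟨σ₀, hσ₀, hG, -⟩ := hGS F E c h2 hc N μ P hN S' A' θ hS' hA' hinert
      exact ⟨σ₀, hσ₀, hG⟩)
    h2 hc hN hN2 hπ η hSA

end Literature.NumberTheory.Automorphic

end
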